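import Literature.AlgebraicGeometry.HodgeTheory.GenericallyFramedChernClasses
import HarnessLib

/-!
# K1 (analytification bridge), step 1: coordinates of algebraic sections in algebraic frames,
# evaluated at complex points — restriction, change of frame, cocycle

Route `EightfoldBlochSeeds` / item `stmt-HodgeConjecture-19780` (`ChernCharacterOnBetti`), helper
(`--supports`). HONEST FRAMING: nothing here proves 19780 / 18880 / 18882 / 18883 / H2 / HC_AV / HC;
no definition, no named fact.

WHAT. For an `𝒪_X`-module `F` on a `ℂ`-scheme `X`, an algebraic frame `s₁, …, s_r` of `F` over a
Zariski open `U` (`HodgeTheory.IsSectionFrame`, Stacks 01C6 / FAC n°41) and a section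
`σ ∈ Γ(F, U')`, the COORDINATE VECTOR of `σ` in the frame `s` at a complex point `P ∈ (U' ∩ U)(ℂ)`
is `(s-coordinates of σ|_{U' ∩ U})(P) ∈ ℂʳ`, the regular-function coordinates evaluated at `P`
(the tree's total evaluation `AlgPoints.evalOrZero`). These are the fibre coordinates of Serre's
analytified bundle `F^h` (GAGA §3 n°9: `F^h = F' ⊗_{𝒪'} 𝓗`, locally `𝓗ʳ` via the frame) in the
trivialisation defined by `s`. This file proves the algebra the topological analytification
(`…AnalytificationCore`, `…AnalytificationExists`) is built from:

* `repr_frame_map` — coordinates commute with restriction to smaller opens;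
* `evalOrZero_add/mul/…` — pointwise algebra of the total evaluation;
* `eval_repr_add`, `eval_repr_smul`, `eval_repr_res` — the evaluated coordinates are additive,
  `𝒪_X`-linear (`(f • σ)(P) = f(P) σ(P)`) and restriction-invariant;
* `eval_repr_self` — the frame vectors themselves have coordinates `e_k`;
* `eval_repr_change` — **change of frame**: the evaluated transition matrix
  `g_{s→t}(P)` carries `s`-coordinates to `t`-coordinates (whence the cocycle rule
  `g_{t→u}(P) g_{s→t}(P) = g_{s→u}(P)` of GAGA §4 n°20 / FAC n°41).

[cite: SerreGAGA1956, §3 n°9 Déf. 2 and §4 n°20] [cite: SerreFAC1955, n°41]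
-/

noncomputable section

-- single-problem summit (Problem = Summit): the mandated namespace repeats `HodgeConjecture`.
set_option linter.dupNamespace false

open CategoryTheory AlgebraicGeometry
open Literature.AlgebraicGeometry.Motives Literature.AlgebraicGeometry.HodgeTheory

namespace Summit.HodgeConjecture.HodgeConjecture.Theorems

variable {X : SchemeOver ℂ} {F : X.left.Modules} {r : ℕ}

/-! ### Pointwise algebra of the total evaluation `evalOrZero` -/

/-- `evalOrZero U (f + g) P = evalOrZero U f P + evalOrZero U g P` (on `U(ℂ)` evaluation is a ring
homomorphism; off `U(ℂ)` all three vanish). [cite: SerreGAGA1956, §2 n°5] -/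
theorem evalOrZero_add (U : X.left.Opens) (f g : Γ(X.left, U)) (P : ComplexPoints X) :
    AlgPoints.evalOrZero U (f + g) P = AlgPoints.evalOrZero U f P + AlgPoints.evalOrZero U g P := by
  by_cases h : P.pt ∈ U
  · simp only [AlgPoints.evalOrZero_of_mem _ h]
    exact map_add (X.left.evaluation U P.pt h ≫ P.resHom).hom f g
  · simp only [AlgPoints.evalOrZero_of_not_mem _ h, add_zero]

/-- `evalOrZero U (f * g) P = evalOrZero U f P * evalOrZero U g P`. [cite: SerreGAGA1956, §2 n°5] -/
theorem evalOrZero_mul (U : X.left.Opens) (f g : Γ(X.left, U)) (P : ComplexPoints X) :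
    AlgPoints.evalOrZero U (f * g) P = AlgPoints.evalOrZero U f P * AlgPoints.evalOrZero U g P := by
  by_cases h : P.pt ∈ U
  · simp only [AlgPoints.evalOrZero_of_mem _ h]
    exact map_mul (X.left.evaluation U P.pt h ≫ P.resHom).hom f g
  · simp only [AlgPoints.evalOrZero_of_not_mem _ h, mul_zero]

/-- `evalOrZero U 0 P = 0`. [cite: SerreGAGA1956, §2 n°5] -/
theorem evalOrZero_zero (U : X.left.Opens) (P : ComplexPoints X) :
    AlgPoints.evalOrZero U (0 : Γ(X.left, U)) P = 0 := by
  by_cases h : P.pt ∈ U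
  · rw [AlgPoints.evalOrZero_of_mem _ h]
    exact map_zero (X.left.evaluation U P.pt h ≫ P.resHom).hom
  · exact AlgPoints.evalOrZero_of_not_mem _ h

/-- `evalOrZero U 1 P = 1` on `U(ℂ)`. [cite: SerreGAGA1956, §2 n°5] -/
theorem evalOrZero_one (U : X.left.Opens) {P : ComplexPoints X} (h : P.pt ∈ U) :
    AlgPoints.evalOrZero U (1 : Γ(X.left, U)) P = 1 := by
  rw [AlgPoints.evalOrZero_of_mem _ h]
  exact map_one (X.left.evaluation U P.pt h ≫ P.resHom).hom

/-- `evalOrZero U (∑ f_k) P = ∑ evalOrZero U f_k P`. [cite: SerreGAGA1956, §2 n°5] -/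
theorem evalOrZero_sum (U : X.left.Opens) {ι : Type*} (S : Finset ι) (f : ι → Γ(X.left, U))
    (P : ComplexPoints X) :
    AlgPoints.evalOrZero U (∑ k ∈ S, f k) P = ∑ k ∈ S, AlgPoints.evalOrZero U (f k) P := by
  classical
  induction S using Finset.induction_on with
  | empty => simp only [Finset.sum_empty, evalOrZero_zero]
  | insert a S ha ih => rw [Finset.sum_insert ha, Finset.sum_insert ha, evalOrZero_add, ih]

/-! ### Coordinates in a frame commute with restriction -/

/-- **Coordinates restrict**: for a frame `s` of `F` over `U`, opens `W ≤ V ≤ U` and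
`σ ∈ Γ(F, V)`, the `s|_W`-coordinates of `σ|_W` are the restrictions of the `s|_V`-coordinates of
`σ` (restriction is `𝒪_X`-semilinear and carries the frame to the frame). [cite: SerreFAC1955, n°41] -/
theorem repr_frame_map {U V W : X.left.Opens} {s : Fin r → Γ(F, U)} (hs : IsSectionFrame F U s)
    (hVU : V ≤ U) (hWV : W ≤ V) (σ : Γ(F, V)) (k : Fin r) :
    (hs.of_le (hWV.trans hVU)).basis.repr (F.presheaf.map (homOfLE hWV).op σ) k =
      X.left.presheaf.map (homOfLE hWV).op ((hs.of_le hVU).basis.repr σ k) := by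
  set b := (hs.of_le hVU).basis with hb
  set b' := (hs.of_le (hWV.trans hVU)).basis with hb'
  have hσ : σ = ∑ i, (b.repr σ i) • b i := (b.sum_repr σ).symm
  have hmap : F.presheaf.map (homOfLE hWV).op σ =
      ∑ i, X.left.presheaf.map (homOfLE hWV).op (b.repr σ i) • b' i := by
    conv_lhs => rw [hσ]
    rw [map_sum]
    refine Finset.sum_congr rfl fun i _ ↦ ?_
    rw [Scheme.Modules.map_smul, hb, hb', IsSectionFrame.basis_apply, IsSectionFrame.basis_apply,
      presheaf_map_map]
  rw [hmap]
  exact congrFun (b'.repr_sum_self fun i ↦ X.left.presheaf.map (homOfLE hWV).op (b.repr σ i)) k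

/-! ### Evaluated coordinates: additivity, linearity, restriction -/

/-- **Additivity** of evaluated coordinates: `(σ + τ)ₛ(P) = σₛ(P) + τₛ(P)`.
[cite: SerreGAGA1956, §3 n°9 Déf. 2] -/
theorem eval_repr_add {U U' : X.left.Opens} {s : Fin r → Γ(F, U)} (hs : IsSectionFrame F U s)
    (σ τ : Γ(F, U')) (P : ComplexPoints X) (k : Fin r) :
    AlgPoints.evalOrZero (U' ⊓ U)
        ((hs.of_le inf_le_right).basis.repr (F.presheaf.map (homOfLE inf_le_left).op (σ + τ)) k) P =
      AlgPoints.evalOrZero (U' ⊓ U)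
          ((hs.of_le inf_le_right).basis.repr (F.presheaf.map (homOfLE inf_le_left).op σ) k) P +
        AlgPoints.evalOrZero (U' ⊓ U)
          ((hs.of_le inf_le_right).basis.repr (F.presheaf.map (homOfLE inf_le_left).op τ) k) P := by
  rw [map_add, map_add, Finsupp.add_apply, evalOrZero_add]

/-- **`𝒪_X`-linearity** of evaluated coordinates: `(f • σ)ₛ(P) = f(P) · σₛ(P)` for `P ∈ (U' ∩ U)(ℂ)`.
[cite: SerreGAGA1956, §3 n°9 Déf. 2] -/
theorem eval_repr_smul {U U' : X.left.Opens} {s : Fin r → Γ(F, U)} (hs : IsSectionFrame F U s)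
    (f : Γ(X.left, U')) (σ : Γ(F, U')) {P : ComplexPoints X} (h' : P.pt ∈ U') (h : P.pt ∈ U)
    (k : Fin r) :
    AlgPoints.evalOrZero (U' ⊓ U)
        ((hs.of_le inf_le_right).basis.repr (F.presheaf.map (homOfLE inf_le_left).op (f • σ)) k) P =
      AlgPoints.evalOrZero U' f P *
        AlgPoints.evalOrZero (U' ⊓ U)
          ((hs.of_le inf_le_right).basis.repr (F.presheaf.map (homOfLE inf_le_left).op σ) k) P := by
  rw [Scheme.Modules.map_smul, map_smul, Finsupp.smul_apply, smul_eq_mul, evalOrZero_mul,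
    AlgPoints.evalOrZero_map_homOfLE inf_le_left f (show P.pt ∈ U' ⊓ U from ⟨h', h⟩)]

/-- **Restriction invariance** of evaluated coordinates: for `W ≤ U'` and `P ∈ (W ∩ U)(ℂ)`,
`(σ|_W)ₛ(P) = σₛ(P)`. [cite: SerreGAGA1956, §3 n°9 Déf. 2] -/
theorem eval_repr_res {U U' W : X.left.Opens} {s : Fin r → Γ(F, U)} (hs : IsSectionFrame F U s)
    (hWU' : W ≤ U') (σ : Γ(F, U')) {P : ComplexPoints X} (hW : P.pt ∈ W) (h : P.pt ∈ U)
    (k : Fin r) :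
    AlgPoints.evalOrZero (W ⊓ U)
        ((hs.of_le inf_le_right).basis.repr
          (F.presheaf.map (homOfLE inf_le_left).op (F.presheaf.map (homOfLE hWU').op σ)) k) P =
      AlgPoints.evalOrZero (U' ⊓ U)
        ((hs.of_le inf_le_right).basis.repr (F.presheaf.map (homOfLE inf_le_left).op σ) k) P := by
  have hWV : W ⊓ U ≤ U' ⊓ U := inf_le_inf hWU' le_rfl
  have key := repr_frame_map hs (inf_le_right : U' ⊓ U ≤ U) hWV
    (F.presheaf.map (homOfLE inf_le_left).op σ) k
  rw [presheaf_map_map] at key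
  rw [presheaf_map_map]
  rw [← AlgPoints.evalOrZero_map_homOfLE hWV _ (show P.pt ∈ W ⊓ U from ⟨hW, h⟩), ← key]

/-! ### The frame vectors and the change of frame -/

/-- **The frame vectors have coordinates `e_k`**: the `s`-coordinates of `s_k` at `P ∈ U(ℂ)` are
`δ_{lk}`. [cite: SerreFAC1955, n°41] -/
theorem eval_repr_self {U : X.left.Opens} {s : Fin r → Γ(F, U)} (hs : IsSectionFrame F U s)
    {P : ComplexPoints X} (h : P.pt ∈ U) (k l : Fin r) :
    AlgPoints.evalOrZero (U ⊓ U)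
        ((hs.of_le inf_le_right).basis.repr (F.presheaf.map (homOfLE inf_le_left).op (s k)) l) P =
      (1 : Matrix (Fin r) (Fin r) ℂ) l k := by
  have hb : F.presheaf.map (homOfLE (inf_le_left : U ⊓ U ≤ U)).op (s k) =
      (hs.of_le (inf_le_right : U ⊓ U ≤ U)).basis k := by
    rw [IsSectionFrame.basis_apply]
  rw [hb, Module.Basis.repr_self, Finsupp.single_apply, Matrix.one_apply]
  by_cases hkl : l = k
  · subst hkl
    rw [if_pos rfl, if_pos rfl, evalOrZero_one _ (show P.pt ∈ U ⊓ U from ⟨h, h⟩)]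
  · rw [if_neg (Ne.symm hkl), if_neg hkl, evalOrZero_zero]

/-- **Change of frame, evaluated at a complex point.** For frames `s` over `U₁`, `t` over `U₂`,
a section `σ ∈ Γ(F, U')` and `P ∈ (U' ∩ U₁ ∩ U₂)(ℂ)`: with the evaluated transition matrix
`g(P)_{lk} = (t-coordinates of s_k)(P)`, one has `Σ_k g(P)_{lk} σₛ(P)_k = σₜ(P)_l`
(both sides are computed on `U' ∩ U₁ ∩ U₂`, where `σ = Σ σₛ,k s_k` and `s_k = Σ g_{lk} t_l`).
[cite: SerreGAGA1956, §4 n°20] [cite: SerreFAC1955, n°41] -/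
theorem eval_repr_change {U₁ U₂ U' : X.left.Opens} {s : Fin r → Γ(F, U₁)} {t : Fin r → Γ(F, U₂)}
    (hs : IsSectionFrame F U₁ s) (ht : IsSectionFrame F U₂ t) (σ : Γ(F, U')) {P : ComplexPoints X}
    (h' : P.pt ∈ U') (h₁ : P.pt ∈ U₁) (h₂ : P.pt ∈ U₂) (l : Fin r) :
    ∑ k, AlgPoints.evalOrZero (U₁ ⊓ U₂)
        ((ht.of_le inf_le_right).basis.repr (F.presheaf.map (homOfLE inf_le_left).op (s k)) l) P *
      AlgPoints.evalOrZero (U' ⊓ U₁)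
        ((hs.of_le inf_le_right).basis.repr (F.presheaf.map (homOfLE inf_le_left).op σ) k) P =
    AlgPoints.evalOrZero (U' ⊓ U₂)
        ((ht.of_le inf_le_right).basis.repr (F.presheaf.map (homOfLE inf_le_left).op σ) l) P := by
  -- everything is computed on the triple intersection `V`
  let V : X.left.Opens := U' ⊓ (U₁ ⊓ U₂)
  have hV12 : V ≤ U₁ ⊓ U₂ := inf_le_right
  have hV'1 : V ≤ U' ⊓ U₁ := inf_le_inf le_rfl inf_le_left
  have hV'2 : V ≤ U' ⊓ U₂ := inf_le_inf le_rfl inf_le_right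
  have hPV : P.pt ∈ V := ⟨h', h₁, h₂⟩
  -- move the three evaluations to `V`
  have e12 : ∀ k, AlgPoints.evalOrZero (U₁ ⊓ U₂)
      ((ht.of_le inf_le_right).basis.repr (F.presheaf.map (homOfLE inf_le_left).op (s k)) l) P =
      AlgPoints.evalOrZero V ((ht.of_le (hV12.trans inf_le_right)).basis.repr
        (F.presheaf.map (homOfLE (hV12.trans inf_le_left)).op (s k)) l) P := by
    intro k
    rw [← AlgPoints.evalOrZero_map_homOfLE hV12 _ hPV, ← repr_frame_map ht inf_le_right hV12,
      presheaf_map_map]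
  have e'1 : ∀ k, AlgPoints.evalOrZero (U' ⊓ U₁)
      ((hs.of_le inf_le_right).basis.repr (F.presheaf.map (homOfLE inf_le_left).op σ) k) P =
      AlgPoints.evalOrZero V ((hs.of_le (hV'1.trans inf_le_right)).basis.repr
        (F.presheaf.map (homOfLE (hV'1.trans inf_le_left)).op σ) k) P := by
    intro k
    rw [← AlgPoints.evalOrZero_map_homOfLE hV'1 _ hPV, ← repr_frame_map hs inf_le_right hV'1,
      presheaf_map_map]
  have e'2 : AlgPoints.evalOrZero (U' ⊓ U₂)
      ((ht.of_le inf_le_right).basis.repr (F.presheaf.map (homOfLE inf_le_left).op σ) l) P =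
      AlgPoints.evalOrZero V ((ht.of_le (hV'2.trans inf_le_right)).basis.repr
        (F.presheaf.map (homOfLE (hV'2.trans inf_le_left)).op σ) l) P := by
    rw [← AlgPoints.evalOrZero_map_homOfLE hV'2 _ hPV, ← repr_frame_map ht inf_le_right hV'2,
      presheaf_map_map]
  -- on `V`: the frame `s|_V` consists of the basis vectors of `(hs.of_le _).basis`
  have hsk : ∀ k, F.presheaf.map (homOfLE (hV12.trans inf_le_left : V ≤ U₁)).op (s k) =
      (hs.of_le (hV'1.trans inf_le_right : V ≤ U₁)).basis k := fun k ↦ by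
    rw [IsSectionFrame.basis_apply]
  rw [e'2]
  refine (Finset.sum_congr rfl fun k _ ↦ show _ = AlgPoints.evalOrZero V
      ((ht.of_le (hV12.trans inf_le_right)).basis.repr ((hs.of_le (hV'1.trans inf_le_right)).basis k) l *
        (hs.of_le (hV'1.trans inf_le_right)).basis.repr
          (F.presheaf.map (homOfLE (hV'1.trans inf_le_left)).op σ) k) P by
    rw [e12, e'1, hsk, ← evalOrZero_mul]).trans ?_
  rw [← evalOrZero_sum]
  congr 1
  exact Module.Basis.sum_repr_mul_repr _ _ _ l

end Summit.HodgeConjecture.HodgeConjecture.Theorems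

end
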